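import Literature.AnabelianGeometry.EtaleTheta.SettingModelChiSemidirect
import Literature.AnabelianGeometry.SemiGraphs.TemperedFreeTwoSlim
import Literature.AnabelianGeometry.SemiGraphs.OncePuncturedTemperedGroupWitness
import Literature.NumberTheory.LocalFields.PadicGaloisSecondCountable
import HarnessLib

/-!
# Root models of [EtTh] §1 (R78 χ-twisted reshape): `Γ = F̂₂ ×_Ẑ ℤ` IS SLIM and `Π^tp_X = Γ ⋊_χ G_{ℚ_p}` IS
# GALOIS-COUNTABLE — the two «honest binders» `hΓ`, `hsc` of the `GroupLevelData (curveχ p)` assembly, discharged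

Mochizuki, *Semi-graphs of anabelioids*, Publ. RIMS **42** (2006) [SemiAnbd], Ex. 3.10 pp. 43–45 («both `Δ` and `Π`
are temp-slim»; «tempered topological group») [cite: MochizukiSemiAnbd2006, Ex 3.10 p.45]; [IUTchI] Rmk. 2.5.3 (i)
(T1) «Galois-countable»; [EtTh] §1 p. 12 [cite: MochizukiEtTh2009, §1 p.12].  abc-iut cell, seat abc-iut-w5-d111
(gen 4); PROOF-ONLY (0 definitions, 0 instances, 0 named facts), by-name instantiation of bricks already in the tree:

* **`isSlimGroup_gfp : IsSlimGroup ↥Gfp`** — the fibre product `Γ := F̂₂ ×_Ẑ ℤ = {(x, n) | ê x = ι n}` of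
  `SettingModel2Curve` (abc-iut-L2-t1 / abc-iut-w5-d218) is SLIM: abc-iut-w5-d218's hypothesis-parametrised
  `TemperedFibreProduct.isSlimGroup` (`SemiGraphs/TemperedFreeTwoSlim.lean`: slices `(V × 0) ∩ Γ`, the centraliser
  condition for free groups in `F̂₂`, evaluations `ê_b`, `ê`) instantiated at `e := eHat` (the completed `a`-exponent
  sum, `σa := expA`), with `ê_b`, `î_a`, `î_b` built by the universal property of the profinite completion exactly as
  in `OncePuncturedTemperedGroupWitness`.  Needed inputs: `expA (of 0) = 1`, `expA (of 1) = 0` (additively).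
* `secondCountableTopology_gfp` — `Γ` is second countable (`TemperedFibreProduct.secondCountableTopology` over
  `secondCountableTopology_profiniteCompletion_freeGroup`).
* **`secondCountableTopology_PiTpχ : SecondCountableTopology (PiTpχ p)`** — abc-iut-w5-d249's carrier
  `Π^tp_X := Γ ⋊_{actχ} G_{ℚ_p}` (topology induced along `(left, right)`) is second countable, from the previous item
  and `Literature.NumberTheory.LocalFields.secondCountableTopology_galQp` (`G_{ℚ_p}` is second countable — Krasner);
  read on the record: `secondCountableTopology_piTemp_curveχ` = the `secondCountableTopology` field of
  `TemperedCurve.GroupLevelData (curveχ p)`.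
These are the binders `hΓ : IsSlimGroup ↥Gfp` and `hsc : SecondCountableTopology (PiTpχ p)` of abc-iut-w5-d249's
conditional assembly `nonempty_groupLevelData_curveχ (hΓ) (hsc)` (SettingModelChiGroupLevel), now theorems.
Semi-synthetic model plumbing, consistency evidence only; nothing of [EtTh]/[SemiAnbd] asserted; no side taken on
[IUTchIII] Cor. 3.12.
-/

noncomputable section

namespace Literature.AnabelianGeometry.EtaleTheta.SettingModel

open Literature.AnabelianGeometry.SemiGraphs
open Literature.AlgebraicGeometry.Frobenioids (IsSlimGroup)
open Literature.IUT.HodgeTheaters (profiniteCompletion toCompletion toCompletion_int_injective)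
open _root_.Topology _root_.Function CategoryTheory

/-! ### The `a`-exponent sum on the free generators -/

/-- `expA a = 1` (additively): the `x`-coordinate of `heisHom (of 0) = (1, 0, 0)`. [cite: MochizukiEtTh2009, §1 p.12] -/
theorem expA_of_zero : expA (FreeGroup.of 0) = Multiplicative.ofAdd 1 := by
  rw [expA_apply]
  simp [heisHom, Heis.gen]

/-- `expA b = 0` (additively): the `x`-coordinate of `heisHom (of 1) = (0, 1, 0)`. [cite: MochizukiEtTh2009, §1 p.12] -/
theorem expA_of_one : expA (FreeGroup.of 1) = 1 := by
  rw [expA_apply]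
  simp [heisHom, Heis.gen]

/-! ### `Γ = F̂₂ ×_Ẑ ℤ` is slim -/

/-- **`Γ := F̂₂ ×_Ẑ ℤ` (SettingModel's `Gfp`) is SLIM** — every open subgroup has trivial centraliser ([SemiAnbd]
Ex. 3.10 p. 45 «temp-slim», at the model): abc-iut-w5-d218's `TemperedFibreProduct.isSlimGroup` instantiated at
`e := eHat`, `σa := expA`, `Γ := Gfp`; the auxiliary `ê_b`, `î_a`, `î_b` are the continuous extensions of the
`b`-exponent sum and of `k ↦ a^k`, `k ↦ b^k`. [cite: MochizukiSemiAnbd2006, Ex 3.10 p.45] -/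
theorem isSlimGroup_gfp : IsSlimGroup Gfp := by
  classical
  let P : ProfiniteGrp.{0} := profiniteCompletion (FreeGroup (Fin 2))
  let Zh : ProfiniteGrp.{0} := profiniteCompletion (Multiplicative ℤ)
  let η : FreeGroup (Fin 2) →* P := toCompletion (FreeGroup (Fin 2))
  let ι : Multiplicative ℤ →* Zh := toCompletion (Multiplicative ℤ)
  let a : FreeGroup (Fin 2) := FreeGroup.of 0
  let b : FreeGroup (Fin 2) := FreeGroup.of 1
  -- the `b`-exponent sum
  let σb : FreeGroup (Fin 2) →* Multiplicative ℤ :=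
    FreeGroup.lift fun j => if j = (1 : Fin 2) then Multiplicative.ofAdd (1 : ℤ) else 1
  have hσaa : expA a = Multiplicative.ofAdd 1 := expA_of_zero
  have hσab : expA b = 1 := expA_of_one
  have hσba : σb a = 1 := by simp [σb, a]
  have hσbb : σb b = Multiplicative.ofAdd 1 := by simp [σb, b]
  -- completions of `σb`, `k ↦ a^k`, `k ↦ b^k`
  let êb : P →ₜ* Zh := (ProfiniteGrp.ProfiniteCompletion.lift (GrpCat.ofHom (ι.comp σb))).hom
  let îa : Zh →ₜ* P :=
    (ProfiniteGrp.ProfiniteCompletion.lift (GrpCat.ofHom (η.comp (zpowersHom _ a)))).hom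
  let îb : Zh →ₜ* P :=
    (ProfiniteGrp.ProfiniteCompletion.lift (GrpCat.ofHom (η.comp (zpowersHom _ b)))).hom
  have he : ∀ g, eHat (η g) = ι (expA g) := fun g => eHat_eta g
  have hêb : ∀ g, êb (η g) = ι (σb g) := fun g => lift_hom_toCompletion Zh (ι.comp σb) g
  have hîa : ∀ k : ℤ, îa (ι (Multiplicative.ofAdd k)) = η (a ^ k) := fun k => by
    rw [lift_hom_toCompletion P (η.comp (zpowersHom _ a))]
    simp [zpowersHom_apply]
  have hîb : ∀ k : ℤ, îb (ι (Multiplicative.ofAdd k)) = η (b ^ k) := fun k => by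
    rw [lift_hom_toCompletion P (η.comp (zpowersHom _ b))]
    simp [zpowersHom_apply]
  have hιinj : Injective ι := toCompletion_int_injective
  have hΓ : ∀ q : P × Multiplicative ℤ, q ∈ Gfp ↔ eHat q.1 = ι q.2 := fun q => mem_Gfp q
  exact TemperedFibreProduct.isSlimGroup eHat êb îa îb expA σb hσaa hσab hσba hσbb he hêb hîa hîb
    hιinj Gfp hΓ

/-! ### Galois-countability -/

/-- `Γ = F̂₂ ×_Ẑ ℤ` is second countable (`F̂₂` is: finitely many subgroups of each index in `F₂`).
[cite: MochizukiSemiAnbd2006, Ex 3.10 p.43] -/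
theorem secondCountableTopology_gfp : SecondCountableTopology Gfp := by
  haveI : SecondCountableTopology F₂hatT := secondCountableTopology_profiniteCompletion_freeGroup (Fin 2)
  exact TemperedFibreProduct.secondCountableTopology Gfp

variable (p : ℕ) [Fact p.Prime]

/-- **`Π^tp_X := Γ ⋊_χ G_{ℚ_p}` of the χ-twisted model (abc-iut-w5-d249's `PiTpχ p`) is Galois-countable**
([IUTchI] Rmk. 2.5.3 (i) (T1); [SemiAnbd] Ex. 3.10): its topology is induced along `(left, right)` into
`Γ × G_{ℚ_p}`, both second countable (`secondCountableTopology_gfp`; `G_{ℚ_p}` by Krasner,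
`Literature.NumberTheory.LocalFields.secondCountableTopology_galQp`). [cite: MochizukiSemiAnbd2006, Ex 3.10 p.43] -/
theorem secondCountableTopology_PiTpχ : SecondCountableTopology (PiTpχ p) := by
  haveI : SecondCountableTopology Gfp := secondCountableTopology_gfp
  haveI : SecondCountableTopology (GQp p) := Literature.NumberTheory.LocalFields.secondCountableTopology_galQp p
  haveI : SecondCountableTopology (Gfp × GQp p) := inferInstance
  exact (isInducing_leftRightχ p).secondCountableTopology

/-- The same, read on the record `curveχ p` (its `PiTemp` is `PiTpχ p`): the `secondCountableTopology` field of
`TemperedCurve.GroupLevelData (curveχ p)`. [cite: MochizukiSemiAnbd2006, Ex 3.10 p.43] -/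
theorem secondCountableTopology_piTemp_curveχ : SecondCountableTopology (curveχ p).PiTemp :=
  secondCountableTopology_PiTpχ p

/-- `G_{ℚ_p}` itself (the arithmetic factor `GQp p`) is second countable — re-read at the abc-iut carrier for
by-name consumers of the χ-model. [cite: MochizukiSemiAnbd2006, Ex 3.10 p.43] -/
theorem secondCountableTopology_GQp : SecondCountableTopology (GQp p) :=
  Literature.NumberTheory.LocalFields.secondCountableTopology_galQp p

end Literature.AnabelianGeometry.EtaleTheta.SettingModel

end
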